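import Summits.FinalStateConjecture.FinalStateConjecture.Theses.ProbeNullTrace

/-!
# Route ProbeNullTrace — support `LinePiercing` (item stmt-FinalStateConjecture-9964)

Finite-dimensional geometric measure theory in `ℝᵏ`, `k = n + 1 ≥ 2`:
if the points of `T` in the punctured `δ`-ball lie in `N ∪ ⋃ i, {g i = 0}` with `μH[k-1] N = 0` and
each `g i` differentiable at `0` with non-zero differential `L i`, then some direction `θ ≠ 0` and
`ε > 0` have `t • θ ∉ T` for all `0 < |t| < ε`.

Proof.  Directions are parametrised by the affine chart `y : Fin n → ℝ ↦ θ y := (1, y)`.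
* The set of chart parameters whose punctured line meets `N` is contained in the image of
  `N ∩ {x₀ ≠ 0}` under the central projection `x ↦ (x₁/x₀, …, xₙ/x₀)`, which is `C¹` on the open
  set `{x₀ ≠ 0}`, hence locally Lipschitz; a countable Lipschitz cover and
  `LipschitzOnWith.hausdorffMeasure_image_le` show the image is `μH[n]`-null, i.e. Lebesgue-null in
  `Fin n → ℝ` (`hausdorffMeasure_pi_real`).
* For each `i`, `{y | L i (θ y) = 0}` is empty or a translate of the kernel of a non-zero linear
  functional, hence Lebesgue-null (`Measure.addHaar_submodule`).
* A parameter `y` outside these null sets gives `θ := θ y ≠ 0`; along `t ↦ g i (t • θ)` the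
  derivative at `0` is `L i θ ≠ 0`, so `g i (t • θ) ≠ 0` on a punctured neighbourhood of `0`
  (`HasDerivAt.eventually_ne`), and `‖t • θ‖ < δ` near `0`.

Sources: Evans–Gariepy 2015 §2.4 (Lipschitz maps and Hausdorff measure), Mattila 1995 ch. 7.
-/

-- the doubled `FinalStateConjecture.FinalStateConjecture` path component trips dupNamespace
set_option linter.dupNamespace false

namespace Summit.FinalStateConjecture.FinalStateConjecture.Theorems

open MeasureTheory Set Filter Topology

/-- A map which is `C¹` on an open set `U` sends `μH[d]`-null subsets of `U` to `μH[d]`-null sets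
(countable cover by Lipschitz pieces). -/
theorem probeNullTrace_hausdorffMeasure_image_null_of_contDiffOn
    {E F : Type*} [NormedAddCommGroup E] [NormedSpace ℝ E] [SecondCountableTopology E]
    [MeasurableSpace E] [BorelSpace E] [NormedAddCommGroup F] [NormedSpace ℝ F]
    [MeasurableSpace F] [BorelSpace F] {f : E → F} {U : Set E} (hU : IsOpen U)
    (hf : ContDiffOn ℝ 1 f U) {d : ℝ} (hd : 0 ≤ d) {N : Set E} (hN : μH[d] N = 0) :
    μH[d] (f '' (N ∩ U)) = 0 := by
  have h : ∀ x ∈ U, ∃ K : NNReal, ∃ t ∈ 𝓝 x, LipschitzOnWith K f t := fun x hx =>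
    (hf.contDiffAt (hU.mem_nhds hx)).exists_lipschitzOnWith
  choose! K t ht hK using h
  obtain ⟨s, hsU, hsc, hUs⟩ := TopologicalSpace.countable_cover_nhdsWithin
    (fun x hx => mem_nhdsWithin_of_mem_nhds (ht x hx))
  have hsub : f '' (N ∩ U) ⊆ ⋃ x ∈ s, f '' (N ∩ t x) := by
    rintro _ ⟨z, ⟨hzN, hzU⟩, rfl⟩
    obtain ⟨x, hx, hzx⟩ := mem_iUnion₂.1 (hUs hzU)
    exact mem_iUnion₂.2 ⟨x, hx, mem_image_of_mem f ⟨hzN, hzx⟩⟩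
  refine measure_mono_null hsub ((measure_biUnion_null_iff hsc).2 fun x hx => ?_)
  have h1 : μH[d] (f '' (N ∩ t x)) ≤ (K x : ENNReal) ^ d * μH[d] (N ∩ t x) :=
    ((hK x (hsU hx)).mono inter_subset_right).hausdorffMeasure_image_le hd
  have h2 : μH[d] (N ∩ t x) = 0 := measure_mono_null inter_subset_left hN
  rw [h2, mul_zero] at h1
  exact nonpos_iff_eq_zero.mp h1

/-- The chart parameters `y` whose punctured line `t • (1, y)`, `t ≠ 0`, meets a `μH[n]`-null set
`N ⊆ ℝⁿ⁺¹` form a Lebesgue-null subset of `Fin n → ℝ`. -/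
theorem probeNullTrace_volume_lineParam_meets_null (n : ℕ)
    (N : Set (EuclideanSpace ℝ (Fin (n + 1)))) (hN : μH[(n : ℝ)] N = 0) :
    volume {y : Fin n → ℝ | ∃ t : ℝ, t ≠ 0 ∧
      t • (WithLp.toLp 2 (Fin.cons 1 y) : EuclideanSpace ℝ (Fin (n + 1))) ∈ N} = 0 := by
  set U : Set (EuclideanSpace ℝ (Fin (n + 1))) := {x | x 0 ≠ 0} with hU_def
  set d : EuclideanSpace ℝ (Fin (n + 1)) → (Fin n → ℝ) := fun x j => x (Fin.succ j) / x 0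
    with hd_def
  have hcont : ∀ i : Fin (n + 1), Continuous fun x : EuclideanSpace ℝ (Fin (n + 1)) => x i :=
    fun i => (continuous_apply i).comp (PiLp.continuous_ofLp 2 _)
  have hU : IsOpen U := isOpen_ne_fun (hcont 0) continuous_const
  have hdiff : ContDiffOn ℝ 1 d U := by
    refine contDiffOn_pi.2 fun j => ?_
    exact (contDiffOn_piLp_apply (p := 2)).div (contDiffOn_piLp_apply (p := 2)) fun x hx => hx
  have himg : μH[(n : ℝ)] (d '' (N ∩ U)) = 0 :=
    probeNullTrace_hausdorffMeasure_image_null_of_contDiffOn hU hdiff (Nat.cast_nonneg n) hN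
  have hvol : (μH[(n : ℝ)] : Measure (Fin n → ℝ)) = volume := by
    have := hausdorffMeasure_pi_real (ι := Fin n)
    rwa [Fintype.card_fin] at this
  rw [← hvol]
  refine measure_mono_null ?_ himg
  rintro y ⟨t, ht, htN⟩
  refine ⟨_, ⟨htN, ?_⟩, ?_⟩
  · show (t • (WithLp.toLp 2 (Fin.cons 1 y) : EuclideanSpace ℝ (Fin (n + 1)))) 0 ≠ 0
    simpa using ht
  · funext j
    simp [hd_def, ht]

/-- For a non-zero continuous linear functional `L` on `ℝⁿ⁺¹`, the chart parameters `y` with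
`L (1, y) = 0` form a Lebesgue-null subset of `Fin n → ℝ` (empty, or a translate of the kernel of a
non-zero linear functional). -/
theorem probeNullTrace_volume_lineParam_ker (n : ℕ)
    (L : EuclideanSpace ℝ (Fin (n + 1)) →L[ℝ] ℝ) (hL : L ≠ 0) :
    volume {y : Fin n → ℝ |
      L (WithLp.toLp 2 (Fin.cons 1 y) : EuclideanSpace ℝ (Fin (n + 1))) = 0} = 0 := by
  -- the linear part `φ y = L (0, y)` and the constant `a = L (1, 0)`
  have hlin : IsLinearMap ℝ fun y : Fin n → ℝ =>
      L (WithLp.toLp 2 (Fin.cons 0 y) : EuclideanSpace ℝ (Fin (n + 1))) := by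
    constructor
    · intro y y'
      rw [← map_add, ← WithLp.toLp_add]
      congr 2
      funext i
      refine Fin.cases ?_ (fun j => ?_) i <;> simp
    · intro c y
      rw [← map_smul, ← WithLp.toLp_smul]
      congr 2
      funext i
      refine Fin.cases ?_ (fun j => ?_) i <;> simp
  set φ : (Fin n → ℝ) →ₗ[ℝ] ℝ := hlin.mk' with hφ_def
  set a : ℝ := L (WithLp.toLp 2 (Fin.cons 1 0) : EuclideanSpace ℝ (Fin (n + 1))) with ha_def
  have hdecomp : ∀ y : Fin n → ℝ,
      L (WithLp.toLp 2 (Fin.cons 1 y) : EuclideanSpace ℝ (Fin (n + 1))) = a + φ y := by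
    intro y
    rw [hφ_def, IsLinearMap.mk'_apply, ha_def, ← map_add, ← WithLp.toLp_add]
    congr 2
    funext i
    refine Fin.cases ?_ (fun j => ?_) i <;> simp
  by_cases hφ : φ = 0
  · -- then `a ≠ 0` (else `L = 0`), so the set is empty
    have ha : a ≠ 0 := by
      intro ha
      apply hL
      ext x
      have hx : x = (x 0) • (WithLp.toLp 2 (Fin.cons 1 0) : EuclideanSpace ℝ (Fin (n + 1))) +
          (WithLp.toLp 2 (Fin.cons 0 (fun j => x (Fin.succ j))) :
            EuclideanSpace ℝ (Fin (n + 1))) := by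
        ext i
        refine Fin.cases ?_ (fun j => ?_) i <;> simp
      have h2 : L (WithLp.toLp 2 (Fin.cons 0 (fun j => x (Fin.succ j))) :
          EuclideanSpace ℝ (Fin (n + 1))) = φ (fun j => x (Fin.succ j)) := by
        rw [hφ_def, IsLinearMap.mk'_apply]
      rw [hx, map_add, map_smul, h2, hφ, ← ha_def, ha]
      simp
    have hempty : {y : Fin n → ℝ |
        L (WithLp.toLp 2 (Fin.cons 1 y) : EuclideanSpace ℝ (Fin (n + 1))) = 0} = ∅ := by
      ext y
      simp only [mem_setOf_eq, mem_empty_iff_false, iff_false, hdecomp, hφ, LinearMap.zero_apply,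
        add_zero]
      exact ha
    rw [hempty, measure_empty]
  · -- `φ ≠ 0`: the set is a translate of `ker φ`, a strict subspace
    obtain ⟨y₁, hy₁⟩ : ∃ y₁, φ y₁ ≠ 0 := by
      by_contra! h
      exact hφ (LinearMap.ext h)
    set y₀ : Fin n → ℝ := (-a / φ y₁) • y₁ with hy₀_def
    have hy₀ : φ y₀ = -a := by
      rw [hy₀_def, map_smul, smul_eq_mul, div_mul_cancel₀ _ hy₁]
    have hset : {y : Fin n → ℝ |
        L (WithLp.toLp 2 (Fin.cons 1 y) : EuclideanSpace ℝ (Fin (n + 1))) = 0} =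
        (fun y => -y₀ + y) ⁻¹' (LinearMap.ker φ : Set (Fin n → ℝ)) := by
      ext y
      simp only [mem_setOf_eq, mem_preimage, SetLike.mem_coe, LinearMap.mem_ker, hdecomp, map_add,
        map_neg, hy₀, neg_neg]
    rw [hset, measure_preimage_add]
    refine Measure.addHaar_submodule volume (LinearMap.ker φ) ?_
    rwa [Ne, LinearMap.ker_eq_top]

/-- **LinePiercing** (route ProbeNullTrace, support item stmt-FinalStateConjecture-9964): in `ℝᵏ`,
`k ≥ 2`, if the points of `T` in the punctured `δ`-ball lie in `N ∪ ⋃ i, {g i = 0}` with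
`μH[k-1] N = 0` and each `g i` differentiable at `0` with non-zero differential, then some `θ ≠ 0`
and `ε > 0` have `t • θ ∉ T` for all `0 < |t| < ε`. -/
theorem linePiercing_proof :
    Summit.FinalStateConjecture.FinalStateConjecture.Theses.ProbeNullTrace.LinePiercing := by
  unfold Summit.FinalStateConjecture.FinalStateConjecture.Theses.ProbeNullTrace.LinePiercing
  intro k hk T N δ m g L hδ hN hgL hT
  obtain ⟨n, rfl⟩ : ∃ n, k = n + 1 := ⟨k - 1, by omega⟩
  have hN' : μH[(n : ℝ)] N = 0 := by
    have : ((n + 1 : ℕ) : ℝ) - 1 = n := by push_cast; ring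
    rwa [this] at hN
  -- the bad chart parameters form a null set
  set θ : (Fin n → ℝ) → EuclideanSpace ℝ (Fin (n + 1)) := fun y => WithLp.toLp 2 (Fin.cons 1 y)
    with hθ_def
  set B : Set (Fin n → ℝ) := {y | ∃ t : ℝ, t ≠ 0 ∧ t • θ y ∈ N} ∪ ⋃ i, {y | L i (θ y) = 0}
    with hB_def
  have hB : volume B = 0 := by
    refine measure_union_null ?_ (measure_iUnion_null fun i => ?_)
    · exact probeNullTrace_volume_lineParam_meets_null n N hN'
    · exact probeNullTrace_volume_lineParam_ker n (L i) (hgL i).2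
  obtain ⟨y, hy⟩ : ∃ y, y ∉ B := by
    by_contra! h
    have huniv : B = univ := eq_univ_of_forall h
    exact IsOpen.measure_ne_zero volume isOpen_univ univ_nonempty (huniv ▸ hB)
  have hyN : ∀ t : ℝ, t ≠ 0 → t • θ y ∉ N := fun t ht htN =>
    hy (Or.inl ⟨t, ht, htN⟩)
  have hyL : ∀ i, L i (θ y) ≠ 0 := fun i hi => hy (Or.inr (mem_iUnion.2 ⟨i, hi⟩))
  have hθ0 : θ y ≠ 0 := by
    intro h
    have : (θ y) 0 = 0 := by rw [h]; rfl
    simp [hθ_def] at this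
  refine ⟨θ y, hθ0, ?_⟩
  -- along the line, each `g i` is eventually non-zero on a punctured neighbourhood of `0`
  have hg_ev : ∀ i, ∀ᶠ t in 𝓝[≠] (0 : ℝ), g i (t • θ y) ≠ 0 := by
    intro i
    have h1 : HasFDerivAt (g i) (L i) ((0 : ℝ) • θ y) := by rw [zero_smul]; exact (hgL i).1
    have h2 : HasDerivAt (fun t : ℝ => g i (t • θ y)) (L i (θ y)) 0 := by
      have h3 : HasDerivAt (fun t : ℝ => t • θ y) ((1 : ℝ) • θ y) 0 :=
        (hasDerivAt_id (0 : ℝ)).smul_const (θ y)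
      have := h1.comp_hasDerivAt (0 : ℝ) h3
      simpa [Function.comp_def, one_smul] using this
    exact h2.eventually_ne (hyL i)
  have hnorm_ev : ∀ᶠ t in 𝓝[≠] (0 : ℝ), ‖t • θ y‖ < δ := by
    refine eventually_nhdsWithin_of_eventually_nhds ?_
    have hc : Continuous fun t : ℝ => ‖t • θ y‖ := (continuous_id.smul continuous_const).norm
    have h0 : ‖(0 : ℝ) • θ y‖ < δ := by simpa using hδ
    exact hc.continuousAt.eventually_lt continuousAt_const h0
  have hall : ∀ᶠ t in 𝓝[≠] (0 : ℝ), ‖t • θ y‖ < δ ∧ ∀ i, g i (t • θ y) ≠ 0 :=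
    hnorm_ev.and (eventually_all.2 hg_ev)
  obtain ⟨ε, hε, hεP⟩ := (Metric.nhdsWithin_basis_ball.eventually_iff).1 hall
  refine ⟨ε, hε, fun t ht htε htT => ?_⟩
  have hmem : t ∈ Metric.ball (0 : ℝ) ε ∩ {(0 : ℝ)}ᶜ :=
    ⟨by simpa [Metric.mem_ball, Real.dist_eq] using htε, ht⟩
  obtain ⟨hlt, hgi⟩ := hεP hmem
  have hne : t • θ y ≠ 0 := smul_ne_zero ht hθ0
  rcases hT (t • θ y) htT hlt hne with hN'' | ⟨i, hi⟩
  · exact hyN t ht hN''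
  · exact hgi i hi

end Summit.FinalStateConjecture.FinalStateConjecture.Theorems
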